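import Summits.KontsevichZagierPeriods.KontsevichZagierPeriods.Theorems.HurwitzMicroSectorsNormalFormPrincipleM3EbdExistsSimplexReps

/-!
# `NormalFormPrinciple` (stmt-KontsevichZagierPeriods-3869), line `SketchIdeator1` —
# leaf `stub_boxRigidity`, layer `L2W3` (level-2 weight-3 descent): the word carriers exist

Pure proof file (stub `l2w3_exists_wordRep` of the layer `L2W3`, lead seat c9; `--supports` the
crux). The four remaining transcendence-free dimension-three instances of the leaf
(`FiveEighthsZetaThree`, `HalfPointZetaThree`, `HalfPointDuality`, `HalfPointZetaTwoLogTwo`) are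
proved by the lead as chains of Kontsevich–Zagier moves between *word representations*
`[Δ, x(t₀)·y(t₁)·z(t₂)]` on the decreasing open simplex `Δ = {t | 0 < t₂ < t₁ < t₀ < 1} ⊆ ℝ³`
(the iterated integral `∫_{1 > t₀ > t₁ > t₂ > 0} x y z`, outermost letter first), the letters being
the four logarithmic forms `a u = 1/u`, `b u = 1/(1−u)`, `c u = 1/(1+u)`, `d u = 1/(2−u)` with the
usual convergence constraint: the first letter is not `b` and the last letter is not `a`.

This file supplies the EXISTENCE of these carriers as honest integral representations
(`Literature.NumberTheory.Transcendental.KZ.IntegralRep 3`) with literally this domain and the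
integrand `t ↦ x (t 0) * y (t 1) * z (t 2)`, uniformly in the letters: `Δ` is the library's open
ordered simplex (`ℚ`-semialgebraic and measurable, layer `M3`); each letter evaluated at a
coordinate is the reciprocal of a `ℚ`-polynomial which does not vanish on `Δ` (all coordinates lie
in `(0,1)`), so the integrand is a product of `ℚ`-semialgebraic functions, continuous on `Δ`; and
on `(0,1)` one has `|x| ≤ 1/u` for `x ∈ {a, c, d}`, `|y| ≤ 1/u + 1/(1−u)` for every letter, and
`|z| ≤ 1/(1−u)` for `z ∈ {b, c, d}`, whence the domination
`|x(t₀) y(t₁) z(t₂)| ≤ 1/(t₀ t₁ (1−t₂)) + 1/(t₀ (1−t₁)(1−t₂))` by the sum of the integrands of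
Kontsevich's absolutely convergent iterated integrals for `ζ(3)` and `ζ(2,1)` (layer `M3`,
`ebd2_integrableOn_G`, `ebd2_integrableOn_H`). No move of the calculus is performed here.

References: M. Kontsevich, D. Zagier, *Periods* (2001), §1.1–1.2; D. Zagier, *Values of zeta
functions and their applications* (1994), §9. No definitions are introduced.
-/

noncomputable section

open MeasureTheory Set
open Literature.NumberTheory.Transcendental Literature.NumberTheory.Transcendental.KZ
open Literature.ModelTheory.ExponentialFields (IsSemialgebraic)

namespace Summit.KontsevichZagierPeriods.HurwitzMicroSectors.NormalFormPrinciple.PiBox.M3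

/-! ## The letters on the decreasing open simplex `Δ = {0 < t₂ < t₁ < t₀ < 1}` -/

/-- Every coordinate of a point of the decreasing open simplex lies in `(0,1)`. [folklore] -/
theorem l2a_coord_mem {t : Fin 3 → ℝ}
    (ht : t ∈ {t : Fin 3 → ℝ | 0 < t 2 ∧ t 2 < t 1 ∧ t 1 < t 0 ∧ t 0 < 1}) :
    ∀ i : Fin 3, 0 < t i ∧ t i < 1 := by
  obtain ⟨h2, h21, h10, h0⟩ := ht
  intro i
  fin_cases i
  exacts [⟨(h2.trans h21).trans h10, h0⟩, ⟨h2.trans h21, h10.trans h0⟩,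
    ⟨h2, (h21.trans h10).trans h0⟩]

/-- The letter `a u = 1/u` at any coordinate is continuous and `ℚ`-semialgebraic on the
decreasing open simplex (reciprocal of a non-vanishing `ℚ`-polynomial).
[cite: KontsevichZagier2001, §1.1] -/
theorem l2a_letter_a (i : Fin 3) :
    ContinuousOn (fun t : Fin 3 → ℝ => 1 / t i)
        {t : Fin 3 → ℝ | 0 < t 2 ∧ t 2 < t 1 ∧ t 1 < t 0 ∧ t 0 < 1} ∧
      IsSemialgebraicFunOn ℚ {t : Fin 3 → ℝ | 0 < t 2 ∧ t 2 < t 1 ∧ t 1 < t 0 ∧ t 0 < 1}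
        (fun t => 1 / t i) := by
  have hne : ∀ t ∈ {t : Fin 3 → ℝ | 0 < t 2 ∧ t 2 < t 1 ∧ t 1 < t 0 ∧ t 0 < 1}, t i ≠ 0 :=
    fun t ht => (l2a_coord_mem ht i).1.ne'
  refine ⟨continuousOn_const.div (continuous_apply i).continuousOn hne, ?_⟩
  refine (isSemialgebraicFunOn_aeval_div_aeval ebd2_isSemialgebraic_simplex
    (1 : MvPolynomial (Fin 3) ℚ) (MvPolynomial.X i) fun t ht => ?_).congr fun t _ => ?_
  · rw [MvPolynomial.aeval_X]
    exact hne t ht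
  · simp only [map_one, MvPolynomial.aeval_X]

/-- The letter `b u = 1/(1−u)` at any coordinate is continuous and `ℚ`-semialgebraic on the
decreasing open simplex. [cite: KontsevichZagier2001, §1.1] -/
theorem l2a_letter_b (i : Fin 3) :
    ContinuousOn (fun t : Fin 3 → ℝ => 1 / (1 - t i))
        {t : Fin 3 → ℝ | 0 < t 2 ∧ t 2 < t 1 ∧ t 1 < t 0 ∧ t 0 < 1} ∧
      IsSemialgebraicFunOn ℚ {t : Fin 3 → ℝ | 0 < t 2 ∧ t 2 < t 1 ∧ t 1 < t 0 ∧ t 0 < 1}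
        (fun t => 1 / (1 - t i)) := by
  have hne : ∀ t ∈ {t : Fin 3 → ℝ | 0 < t 2 ∧ t 2 < t 1 ∧ t 1 < t 0 ∧ t 0 < 1}, 1 - t i ≠ 0 :=
    fun t ht => (sub_pos.2 (l2a_coord_mem ht i).2).ne'
  refine ⟨continuousOn_const.div (continuousOn_const.sub (continuous_apply i).continuousOn) hne,
    ?_⟩
  refine (isSemialgebraicFunOn_aeval_div_aeval ebd2_isSemialgebraic_simplex
    (1 : MvPolynomial (Fin 3) ℚ) (1 - MvPolynomial.X i) fun t ht => ?_).congr fun t _ => ?_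
  · rw [map_sub, map_one, MvPolynomial.aeval_X]
    exact hne t ht
  · simp only [map_sub, map_one, MvPolynomial.aeval_X]

/-- The letter `c u = 1/(1+u)` at any coordinate is continuous and `ℚ`-semialgebraic on the
decreasing open simplex. [cite: KontsevichZagier2001, §1.1] -/
theorem l2a_letter_c (i : Fin 3) :
    ContinuousOn (fun t : Fin 3 → ℝ => 1 / (1 + t i))
        {t : Fin 3 → ℝ | 0 < t 2 ∧ t 2 < t 1 ∧ t 1 < t 0 ∧ t 0 < 1} ∧
      IsSemialgebraicFunOn ℚ {t : Fin 3 → ℝ | 0 < t 2 ∧ t 2 < t 1 ∧ t 1 < t 0 ∧ t 0 < 1}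
        (fun t => 1 / (1 + t i)) := by
  have hne : ∀ t ∈ {t : Fin 3 → ℝ | 0 < t 2 ∧ t 2 < t 1 ∧ t 1 < t 0 ∧ t 0 < 1}, 1 + t i ≠ 0 :=
    fun t ht => (add_pos one_pos (l2a_coord_mem ht i).1).ne'
  refine ⟨continuousOn_const.div (continuousOn_const.add (continuous_apply i).continuousOn) hne,
    ?_⟩
  refine (isSemialgebraicFunOn_aeval_div_aeval ebd2_isSemialgebraic_simplex
    (1 : MvPolynomial (Fin 3) ℚ) (1 + MvPolynomial.X i) fun t ht => ?_).congr fun t _ => ?_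
  · rw [map_add, map_one, MvPolynomial.aeval_X]
    exact hne t ht
  · simp only [map_add, map_one, MvPolynomial.aeval_X]

/-- The letter `d u = 1/(2−u)` at any coordinate is continuous and `ℚ`-semialgebraic on the
decreasing open simplex. [cite: KontsevichZagier2001, §1.1] -/
theorem l2a_letter_d (i : Fin 3) :
    ContinuousOn (fun t : Fin 3 → ℝ => 1 / (2 - t i))
        {t : Fin 3 → ℝ | 0 < t 2 ∧ t 2 < t 1 ∧ t 1 < t 0 ∧ t 0 < 1} ∧
      IsSemialgebraicFunOn ℚ {t : Fin 3 → ℝ | 0 < t 2 ∧ t 2 < t 1 ∧ t 1 < t 0 ∧ t 0 < 1}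
        (fun t => 1 / (2 - t i)) := by
  have hne : ∀ t ∈ {t : Fin 3 → ℝ | 0 < t 2 ∧ t 2 < t 1 ∧ t 1 < t 0 ∧ t 0 < 1}, 2 - t i ≠ 0 :=
    fun t ht => (show (0:ℝ) < 2 - t i by linarith [(l2a_coord_mem ht i).2]).ne'
  refine ⟨continuousOn_const.div (continuousOn_const.sub (continuous_apply i).continuousOn) hne,
    ?_⟩
  refine (isSemialgebraicFunOn_aeval_div_aeval ebd2_isSemialgebraic_simplex
    (1 : MvPolynomial (Fin 3) ℚ) (2 - MvPolynomial.X i) fun t ht => ?_).congr fun t _ => ?_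
  · simp only [map_sub, map_ofNat, MvPolynomial.aeval_X]
    exact hne t ht
  · simp only [map_sub, map_ofNat, map_one, MvPolynomial.aeval_X]

/-- Elementary domination of a reciprocal: `0 < v ≤ w` gives `|1/w| ≤ 1/v`. [folklore] -/
theorem l2a_abs_one_div_le {v w : ℝ} (hv : 0 < v) (hvw : v ≤ w) : |1 / w| ≤ 1 / v := by
  rw [abs_of_pos (one_div_pos.2 (hv.trans_le hvw))]
  exact one_div_le_one_div_of_le hv hvw

/-! ## Letter classes: first, middle, last -/

/-- **First letters** `x ∈ {a, c, d}` (regular at `u = 1`): continuous and `ℚ`-semialgebraic at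
every coordinate of the decreasing open simplex, and `|x u| ≤ 1/u` on `(0,1)`.
[cite: KontsevichZagier2001, §1.1] -/
theorem l2a_first {x : ℝ → ℝ}
    (hx : x ∈ ({fun u => 1 / u, fun u => 1 / (1 + u), fun u => 1 / (2 - u)} : Set (ℝ → ℝ))) :
    (∀ i : Fin 3,
      ContinuousOn (fun t : Fin 3 → ℝ => x (t i))
          {t : Fin 3 → ℝ | 0 < t 2 ∧ t 2 < t 1 ∧ t 1 < t 0 ∧ t 0 < 1} ∧
        IsSemialgebraicFunOn ℚ {t : Fin 3 → ℝ | 0 < t 2 ∧ t 2 < t 1 ∧ t 1 < t 0 ∧ t 0 < 1}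
          (fun t => x (t i))) ∧
    ∀ u : ℝ, 0 < u → u < 1 → |x u| ≤ 1 / u := by
  rcases hx with rfl | rfl | rfl
  · exact ⟨l2a_letter_a, fun u hu _ => l2a_abs_one_div_le hu le_rfl⟩
  · exact ⟨l2a_letter_c, fun u hu _ => l2a_abs_one_div_le hu (by linarith : u ≤ 1 + u)⟩
  · exact ⟨l2a_letter_d, fun u hu hu1 => l2a_abs_one_div_le hu (by linarith : u ≤ 2 - u)⟩

/-- **Middle letters** `y ∈ {a, b, c, d}`: continuous and `ℚ`-semialgebraic at every coordinate
of the decreasing open simplex, and `|y u| ≤ 1/u + 1/(1−u)` on `(0,1)`.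
[cite: KontsevichZagier2001, §1.1] -/
theorem l2a_middle {y : ℝ → ℝ}
    (hy : y ∈ ({fun u => 1 / u, fun u => 1 / (1 - u), fun u => 1 / (1 + u), fun u => 1 / (2 - u)} :
      Set (ℝ → ℝ))) :
    (∀ i : Fin 3,
      ContinuousOn (fun t : Fin 3 → ℝ => y (t i))
          {t : Fin 3 → ℝ | 0 < t 2 ∧ t 2 < t 1 ∧ t 1 < t 0 ∧ t 0 < 1} ∧
        IsSemialgebraicFunOn ℚ {t : Fin 3 → ℝ | 0 < t 2 ∧ t 2 < t 1 ∧ t 1 < t 0 ∧ t 0 < 1}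
          (fun t => y (t i))) ∧
    ∀ u : ℝ, 0 < u → u < 1 → |y u| ≤ 1 / u + 1 / (1 - u) := by
  rcases hy with rfl | rfl | rfl | rfl
  · exact ⟨l2a_letter_a, fun u hu hu1 => (l2a_abs_one_div_le hu le_rfl).trans
      (le_add_of_nonneg_right (one_div_pos.2 (sub_pos.2 hu1)).le)⟩
  · exact ⟨l2a_letter_b, fun u hu hu1 => (l2a_abs_one_div_le (sub_pos.2 hu1) le_rfl).trans
      (le_add_of_nonneg_left (one_div_pos.2 hu).le)⟩
  · exact ⟨l2a_letter_c, fun u hu hu1 =>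
      (l2a_abs_one_div_le hu (by linarith : u ≤ 1 + u)).trans
        (le_add_of_nonneg_right (one_div_pos.2 (sub_pos.2 hu1)).le)⟩
  · exact ⟨l2a_letter_d, fun u hu hu1 =>
      (l2a_abs_one_div_le hu (by linarith : u ≤ 2 - u)).trans
        (le_add_of_nonneg_right (one_div_pos.2 (sub_pos.2 hu1)).le)⟩

/-- **Last letters** `z ∈ {b, c, d}` (regular at `u = 0`): continuous and `ℚ`-semialgebraic at
every coordinate of the decreasing open simplex, and `|z u| ≤ 1/(1−u)` on `(0,1)`.
[cite: KontsevichZagier2001, §1.1] -/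
theorem l2a_last {z : ℝ → ℝ}
    (hz : z ∈ ({fun u => 1 / (1 - u), fun u => 1 / (1 + u), fun u => 1 / (2 - u)} : Set (ℝ → ℝ))) :
    (∀ i : Fin 3,
      ContinuousOn (fun t : Fin 3 → ℝ => z (t i))
          {t : Fin 3 → ℝ | 0 < t 2 ∧ t 2 < t 1 ∧ t 1 < t 0 ∧ t 0 < 1} ∧
        IsSemialgebraicFunOn ℚ {t : Fin 3 → ℝ | 0 < t 2 ∧ t 2 < t 1 ∧ t 1 < t 0 ∧ t 0 < 1}
          (fun t => z (t i))) ∧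
    ∀ u : ℝ, 0 < u → u < 1 → |z u| ≤ 1 / (1 - u) := by
  rcases hz with rfl | rfl | rfl
  · exact ⟨l2a_letter_b, fun u _ hu1 => l2a_abs_one_div_le (sub_pos.2 hu1) le_rfl⟩
  · exact ⟨l2a_letter_c, fun u hu hu1 =>
      l2a_abs_one_div_le (sub_pos.2 hu1) (by linarith : 1 - u ≤ 1 + u)⟩
  · exact ⟨l2a_letter_d, fun u _ hu1 =>
      l2a_abs_one_div_le (sub_pos.2 hu1) (by linarith : 1 - u ≤ 2 - u)⟩

/-! ## Absolute convergence: domination by `ζ(3) + ζ(2,1)` -/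

/-- **Domination of a word integrand.** If `x`, `y`, `z` are continuous on the decreasing open
simplex at the coordinates `0`, `1`, `2` and satisfy `|x u| ≤ 1/u`, `|y u| ≤ 1/u + 1/(1−u)`,
`|z u| ≤ 1/(1−u)` on `(0,1)`, then `t ↦ x(t₀) y(t₁) z(t₂)` is integrable on the simplex: it is
dominated by `1/(t₀ t₁ (1−t₂)) + 1/(t₀ (1−t₁)(1−t₂))`, the sum of the integrands of Kontsevich's
absolutely convergent iterated integrals for `ζ(3)` and `ζ(2,1)`. [cite: Zagier1994, §9] -/
theorem l2a_integrableOn_word {x y z : ℝ → ℝ}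
    (hxc : ContinuousOn (fun t : Fin 3 → ℝ => x (t 0))
      {t : Fin 3 → ℝ | 0 < t 2 ∧ t 2 < t 1 ∧ t 1 < t 0 ∧ t 0 < 1})
    (hyc : ContinuousOn (fun t : Fin 3 → ℝ => y (t 1))
      {t : Fin 3 → ℝ | 0 < t 2 ∧ t 2 < t 1 ∧ t 1 < t 0 ∧ t 0 < 1})
    (hzc : ContinuousOn (fun t : Fin 3 → ℝ => z (t 2))
      {t : Fin 3 → ℝ | 0 < t 2 ∧ t 2 < t 1 ∧ t 1 < t 0 ∧ t 0 < 1})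
    (hxb : ∀ u : ℝ, 0 < u → u < 1 → |x u| ≤ 1 / u)
    (hyb : ∀ u : ℝ, 0 < u → u < 1 → |y u| ≤ 1 / u + 1 / (1 - u))
    (hzb : ∀ u : ℝ, 0 < u → u < 1 → |z u| ≤ 1 / (1 - u)) :
    IntegrableOn (fun t : Fin 3 → ℝ => x (t 0) * y (t 1) * z (t 2))
      {t : Fin 3 → ℝ | 0 < t 2 ∧ t 2 < t 1 ∧ t 1 < t 0 ∧ t 0 < 1} := by
  have hsum : IntegrableOn
      (fun t : Fin 3 → ℝ => 1 / (t 0 * t 1 * (1 - t 2)) + 1 / (t 0 * (1 - t 1) * (1 - t 2)))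
      {t : Fin 3 → ℝ | 0 < t 2 ∧ t 2 < t 1 ∧ t 1 < t 0 ∧ t 0 < 1} :=
    ebd2_integrableOn_G.add ebd2_integrableOn_H
  refine Integrable.mono' hsum
    (((hxc.mul hyc).mul hzc).aestronglyMeasurable ebd2_measurableSet_simplex)
    (ae_restrict_of_forall_mem ebd2_measurableSet_simplex fun t ht => ?_)
  obtain ⟨h0, h1, h1', -⟩ := ebd2_pos_of_mem_simplex ht
  have hc := l2a_coord_mem ht
  have hx' := hxb (t 0) (hc 0).1 (hc 0).2
  have hy' := hyb (t 1) (hc 1).1 (hc 1).2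
  have hz' := hzb (t 2) (hc 2).1 (hc 2).2
  rw [Real.norm_eq_abs, abs_mul, abs_mul]
  calc |x (t 0)| * |y (t 1)| * |z (t 2)|
      ≤ 1 / t 0 * (1 / t 1 + 1 / (1 - t 1)) * (1 / (1 - t 2)) :=
        mul_le_mul (mul_le_mul hx' hy' (abs_nonneg _) (by positivity)) hz' (abs_nonneg _)
          (by positivity)
    _ = 1 / t 0 * (1 / t 1) * (1 / (1 - t 2)) + 1 / t 0 * (1 / (1 - t 1)) * (1 / (1 - t 2)) := by
        ring
    _ = 1 / (t 0 * t 1 * (1 - t 2)) + 1 / (t 0 * (1 - t 1) * (1 - t 2)) := by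
        simp only [one_div_mul_one_div]

/-! ## The registered sub-goal -/

/-- **Stub L1 (existence of the word carriers; registered sub-goal `l2w3_exists_wordRep` of
stmt-KontsevichZagierPeriods-3869, line `SketchIdeator1`, layer `L2W3`).** For letters
`x ∈ {a, c, d}`, `y ∈ {a, b, c, d}`, `z ∈ {b, c, d}` (`a u = 1/u`, `b u = 1/(1−u)`,
`c u = 1/(1+u)`, `d u = 1/(2−u)`) the word representation `[Δ, x(t₀)·y(t₁)·z(t₂)]` on the
decreasing open simplex `Δ = {0 < t₂ < t₁ < t₀ < 1}` — the absolutely convergent iterated integral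
`∫_{1 > t₀ > t₁ > t₂ > 0} x y z` — exists as an integral representation of the Kontsevich–Zagier
calculus with literally this domain and integrand. [cite: KontsevichZagier2001, §1.1] -/
theorem l2w3_exists_wordRep :
    ∀ (x y z : ℝ → ℝ),
      x ∈ ({fun u => 1 / u, fun u => 1 / (1 + u), fun u => 1 / (2 - u)} : Set (ℝ → ℝ)) →
      y ∈ ({fun u => 1 / u, fun u => 1 / (1 - u), fun u => 1 / (1 + u), fun u => 1 / (2 - u)} :
        Set (ℝ → ℝ)) →
      z ∈ ({fun u => 1 / (1 - u), fun u => 1 / (1 + u), fun u => 1 / (2 - u)} : Set (ℝ → ℝ)) →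
      ∃ T : IntegralRep 3, T.domain = {t | 0 < t 2 ∧ t 2 < t 1 ∧ t 1 < t 0 ∧ t 0 < 1} ∧
        T.integrand = fun t => x (t 0) * y (t 1) * z (t 2) := by
  intro x y z hx hy hz
  obtain ⟨hxf, hxb⟩ := l2a_first hx
  obtain ⟨hyf, hyb⟩ := l2a_middle hy
  obtain ⟨hzf, hzb⟩ := l2a_last hz
  exact ⟨⟨{t | 0 < t 2 ∧ t 2 < t 1 ∧ t 1 < t 0 ∧ t 0 < 1}, fun t => x (t 0) * y (t 1) * z (t 2),
    ebd2_isSemialgebraic_simplex,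
    (IsSemialgebraicFunOn.mul_holds (IsSemialgebraicFunOn.mul_holds (hxf 0).2 (hyf 1).2)
      (hzf 2).2).congr fun _ _ => rfl,
    l2a_integrableOn_word (hxf 0).1 (hyf 1).1 (hzf 2).1 hxb hyb hzb⟩, rfl, rfl⟩

end Summit.KontsevichZagierPeriods.HurwitzMicroSectors.NormalFormPrinciple.PiBox.M3
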